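import Summits.ResolutionOfSingularities.ResolutionOfSingularities.Theorems.EigenLadderLU2
import HarnessLib

/-!
# EigenLadderLU2B — decomp-res node «EigenLadder» (lens-1 g24, CRITIC-LEDGER row 187 CLEARED
DECIDED-MOD-D +1 · MAP 0): continuation of `EigenLadderLU2`

PART B — THE FRAME IS COMPUTED, NOT GIVEN: Reynolds production of the Kummer parameter /
eigen-coordinate from a `σ`-stable hyperplane (`eigenCoordinate_of_stableHyperplane`,
`kummerFrame_of_stableHyperplane` — the frame law, hypothesis-free).

[WRITER NOTE (decomp-res writer g12): the gate caps Theorems files with proofs at 400 lines, so the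
lens's tree file `EigenLadderLU2.lean` (455 l, sha256 a5c2fc0d…) is landed as TWO modules split at a
namespace-block boundary — `EigenLadderLU2` (PART C2 invariant generators (Hermite basis `invGen`,
`fixed_iff_mem_adjoin_invGen`, algebraic independence)) and `EigenLadderLU2B` (PART B
eigen-coordinates by Reynolds averaging) — content VERBATIM (plus bookkeeping docstrings on
undocumented simp lemmas); the node's import chain becomes EigenLadderLU → EigenLadderLU1B →
EigenLadderLU2 → EigenLadderLU2B → EigenLadderLU3 → EigenLadderLU4 → EigenLadderLU5 →
EigenLadderLU5B → EigenLadderLU6 (one namespace `…Theorems.EigenLadderLU` throughout).]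
-/

namespace Summit.ResolutionOfSingularities.ResolutionOfSingularities.Theorems.EigenLadderLU

open Literature.AlgebraicGeometry.Resolution
open Summit.ResolutionOfSingularities.ResolutionOfSingularities.Theorems
open Summit.ResolutionOfSingularities.ResolutionOfSingularities.Theorems.AdaptedChartHensel
open Summit.ResolutionOfSingularities.ResolutionOfSingularities.Theorems.KeyChainLU

/-! ## PART B — THE FRAME IS COMPUTED, NOT GIVEN: Reynolds production of the Kummer parameter from a
`σ`-stable hyperplane -/

section Frame

variable {k : Type} [Field k] {L : Type} [Field L] [Algebra k L]

/-- Non-zero constants are units of every valuation ring containing the constants. [folklore] -/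
theorem valuation_algebraMap_eq_one (O' : ValuationSubring L) (hkO : ∀ c : k, algebraMap k L c ∈ O')
    {c : k} (hc : c ≠ 0) : O'.valuation (algebraMap k L c) = 1 := by
  apply le_antisymm ((O'.valuation_le_one_iff _).mpr (hkO c))
  have h1 : O'.valuation (algebraMap k L c) * O'.valuation (algebraMap k L c⁻¹) = 1 := by
    rw [← map_mul, ← map_mul, mul_inv_cancel₀ hc, map_one, map_one]
  have h2 : O'.valuation (algebraMap k L c⁻¹) ≤ 1 := (O'.valuation_le_one_iff _).mpr (hkO _)
  calc (1 : _) = _ := h1.symm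
    _ ≤ O'.valuation (algebraMap k L c) * 1 := mul_le_mul_right h2 _
    _ = _ := mul_one _

/-- **FRAME LAW (PART B), one coordinate, any root of unity — an eigen-parameter is COMPUTED by the
twisted Reynolds operator.**  Let `(A, u₀, …, u₃)` present the maximal ideal of the local ring `A_𝔮` of
a chart contained in `O'`, `A` `σ`-stable, and suppose the HYPERPLANE `(u_j)` is `⟨σ⟩`-stable with
residual eigenvalue `ζ` (`ζ ^ ℓ = 1`, not necessarily primitive), in the concrete cocycle form:
`σⁱ(u_j) · bᵢ = aᵢ · u_j` with `aᵢ, bᵢ ∈ A`, `v'(bᵢ) = 0` and `aᵢ ≡ ζⁱ bᵢ` (`i < ℓ`).  Then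
`x_j := P_ζ(u_j) = ∑ ζ^{-i} σⁱ(u_j)` (`reynolds`) replaces `u_j`: the other coordinates are kept, the new
family presents the same maximal ideal, `v'(x_j) = v'(u_j)`, and `σ x_j = ζ x_j`.  (Cossart–Piltant's
averaging (29)–(30), here with the value control that keeps the chart VALUE-ADAPTED: `x_j = (α/β) u_j`
with `α ≡ ℓ β`, `β = ∏ bᵢ` units of `A_𝔮`.) [CossartPiltant2008, proof of Prop. 6.2 (2), (29)–(30)]
[folklore] -/
theorem eigenCoordinate_of_stableHyperplane (σ : L ≃ₐ[k] L) {ℓ : ℕ} (hℓ : 0 < ℓ) (hℓk : (ℓ : k) ≠ 0)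
    (hσℓ : σ ^ ℓ = 1) {ζ : k} (hζℓ : ζ ^ ℓ = 1) (O' : ValuationSubring L)
    (A : Subalgebra k L) (hAO : A.toSubring ≤ O'.toSubring) (hAσ : ∀ a ∈ A, σ a ∈ A)
    (u : Fin 4 → L) (hu : ∀ i, u i ∈ A)
    (hmax : IsLocalRing.maximalIdeal (Localization.AtPrime (centreIdeal A O' hAO)) =
      Ideal.span (Set.range fun i =>
        algebraMap A (Localization.AtPrime (centreIdeal A O' hAO)) ⟨u i, hu i⟩))
    (j : Fin 4) (a b : ℕ → L) (haA : ∀ i, i < ℓ → a i ∈ A) (hbA : ∀ i, i < ℓ → b i ∈ A)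
    (hb1 : ∀ i, i < ℓ → O'.valuation (b i) = 1)
    (horb : ∀ i, i < ℓ → (σ ^ i) (u j) * b i = a i * u j)
    (hres : ∀ i, i < ℓ → O'.valuation (a i - algebraMap k L (ζ ^ i) * b i) < 1) :
    ∃ (x : Fin 4 → L) (hx : ∀ i, x i ∈ A),
      x j = reynolds σ (ζ ^ (ℓ - 1)) ℓ 1 (u j) ∧ (∀ i, i ≠ j → x i = u i) ∧
      σ (x j) = algebraMap k L ζ * x j ∧ (∀ i, O'.valuation (x i) = O'.valuation (u i)) ∧
      IsLocalRing.maximalIdeal (Localization.AtPrime (centreIdeal A O' hAO)) =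
        Ideal.span (Set.range fun i =>
          algebraMap A (Localization.AtPrime (centreIdeal A O' hAO)) ⟨x i, hx i⟩) := by
  have hAO' : ∀ a ∈ A, a ∈ O' := fun a ha => hAO ha
  have hkO : ∀ c : k, algebraMap k L c ∈ O' := fun c => hAO' _ (A.algebraMap_mem c)
  have hvle : ∀ a ∈ A, O'.valuation a ≤ 1 := fun a ha => (O'.valuation_le_one_iff _).mpr (hAO' a ha)
  set ζ' := ζ ^ (ℓ - 1) with hζ'def
  have hζζ' : ζ * ζ' = 1 := by rw [hζ'def, ← pow_succ', Nat.sub_add_cancel hℓ, hζℓ]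
  set x₀ := reynolds σ ζ' ℓ 1 (u j) with hx₀def
  have hx₀A : x₀ ∈ A := reynolds_mem σ ζ' ℓ 1 A hAσ (hu j)
  have hσx₀ : σ x₀ = algebraMap k L ζ * x₀ := by
    have h := sigma_reynolds σ hℓ hσℓ ζ ζ' hζζ' hζℓ 1 (u j)
    rwa [pow_one] at h
  have hb0 : ∀ i, i < ℓ → b i ≠ 0 := by
    intro i hi h
    have h1 := hb1 i hi
    rw [h, map_zero] at h1
    exact zero_ne_one h1
  have hc : ∀ i, i < ℓ → (σ ^ i) (u j) = (a i / b i) * u j := by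
    intro i hi
    rw [div_mul_eq_mul_div, ← horb i hi, mul_div_cancel_right₀ _ (hb0 i hi)]
  have hx₀eq : x₀ = (∑ i ∈ Finset.range ℓ, algebraMap k L (ζ' ^ (1 * i)) * (a i / b i)) * u j :=
    reynolds_eq_mul_of_iterates σ ζ' ℓ 1 (fun i => a i / b i) hc
  -- `β = ∏ bᵢ`, `α = ∑ ζ'^i aᵢ ∏_{j ≠ i} bⱼ`
  set β := ∏ i ∈ Finset.range ℓ, b i with hβdef
  set α := ∑ i ∈ Finset.range ℓ, algebraMap k L (ζ' ^ i) * a i *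
    ∏ j ∈ (Finset.range ℓ).erase i, b j with hαdef
  have hβA : β ∈ A := prod_mem fun i hi => hbA i (Finset.mem_range.mp hi)
  have hPA : ∀ i, (∏ j ∈ (Finset.range ℓ).erase i, b j) ∈ A := fun i =>
    prod_mem fun j hj => hbA j (Finset.mem_range.mp (Finset.mem_of_mem_erase hj))
  have hαA : α ∈ A := sum_mem fun i hi =>
    mul_mem (mul_mem (A.algebraMap_mem _) (haA i (Finset.mem_range.mp hi))) (hPA i)
  have hβ1 : O'.valuation β = 1 := by
    rw [hβdef, map_prod]
    exact Finset.prod_eq_one fun i hi => hb1 i (Finset.mem_range.mp hi)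
  -- `x₀ β = α u_j`
  have hkey : x₀ * β = α * u j := by
    rw [hx₀eq, mul_right_comm]
    congr 1
    rw [hαdef, Finset.sum_mul]
    refine Finset.sum_congr rfl fun i hi => ?_
    have hbi := hb0 i (Finset.mem_range.mp hi)
    rw [one_mul, hβdef, ← Finset.mul_prod_erase (Finset.range ℓ) b hi]
    field_simp
  -- `v'(α − ℓ β) < 1`, hence `v'(α) = 1`
  have hαβ : O'.valuation (α - (ℓ : L) * β) < 1 := by
    have hℓβ : (ℓ : L) * β = ∑ i ∈ Finset.range ℓ, b i * ∏ j ∈ (Finset.range ℓ).erase i, b j := by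
      rw [Finset.sum_congr rfl fun i hi => Finset.mul_prod_erase (Finset.range ℓ) b hi,
        Finset.sum_const, Finset.card_range, nsmul_eq_mul]
    have hdec : α - (ℓ : L) * β = ∑ i ∈ Finset.range ℓ, algebraMap k L (ζ' ^ i) *
        (a i - algebraMap k L (ζ ^ i) * b i) * ∏ j ∈ (Finset.range ℓ).erase i, b j := by
      rw [hℓβ, hαdef, ← Finset.sum_sub_distrib]
      refine Finset.sum_congr rfl fun i _ => ?_
      have h1 : algebraMap k L (ζ' ^ i) * algebraMap k L (ζ ^ i) = 1 := by
        rw [← map_mul, ← mul_pow, mul_comm, hζζ', one_pow, map_one]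
      linear_combination (b i * ∏ j ∈ (Finset.range ℓ).erase i, b j) * h1
    rw [hdec]
    refine O'.valuation.map_sum_lt one_ne_zero fun i hi => ?_
    have hi' := Finset.mem_range.mp hi
    rw [map_mul, map_mul]
    calc O'.valuation (algebraMap k L (ζ' ^ i)) * O'.valuation (a i - algebraMap k L (ζ ^ i) * b i) *
          O'.valuation (∏ j ∈ (Finset.range ℓ).erase i, b j)
        ≤ 1 * O'.valuation (a i - algebraMap k L (ζ ^ i) * b i) * 1 :=
          mul_le_mul' (mul_le_mul' ((O'.valuation_le_one_iff _).mpr (hkO _)) le_rfl)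
            (hvle _ (hPA i))
      _ < 1 := by rw [one_mul, mul_one]; exact hres i hi'
  have hℓ1 : O'.valuation ((ℓ : L)) = 1 := by
    rw [← map_natCast (algebraMap k L)]
    exact valuation_algebraMap_eq_one O' hkO hℓk
  have hα1 : O'.valuation α = 1 := by
    have h : α = (α - (ℓ : L) * β) + (ℓ : L) * β := by ring
    rw [h, Valuation.map_add_eq_of_lt_right _ (by rw [map_mul, hℓ1, hβ1, one_mul]; exact hαβ),
      map_mul, hℓ1, hβ1, one_mul]
  have hx₀v : O'.valuation x₀ = O'.valuation (u j) := by
    have h := congrArg O'.valuation hkey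
    rwa [map_mul, map_mul, hβ1, hα1, mul_one, one_mul] at h
  -- the new chart
  let x : Fin 4 → L := fun i => if i = j then x₀ else u i
  have hx0 : x j = x₀ := if_pos rfl
  have hxne : ∀ i, i ≠ j → x i = u i := fun i hi => if_neg hi
  have hxA : ∀ i, x i ∈ A := by
    intro i
    by_cases hi : i = j
    · rw [hi, hx0]; exact hx₀A
    · rw [hxne i hi]; exact hu _
  refine ⟨x, hxA, hx0, hxne, by rw [hx0]; exact hσx₀, ?_, ?_⟩
  · intro i
    by_cases hi : i = j
    · rw [hi, hx0, hx₀v]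
    · rw [hxne i hi]
  · -- the span in `A_𝔮`: `x_j = (α/β) u_j` with `α, β` units
    set Aq := Localization.AtPrime (centreIdeal A O' hAO) with hAqdef
    have hunit : ∀ (z : L) (hz : z ∈ A), O'.valuation z = 1 →
        IsUnit (algebraMap A Aq ⟨z, hz⟩) := by
      intro z hz hz1
      have hnot : (⟨z, hz⟩ : A) ∉ centreIdeal A O' hAO := fun h => by
        have h' := (KeyChainLU.mem_centreIdeal_iff A hAO ⟨z, hz⟩).mp h
        change O'.valuation z < 1 at h'
        rw [hz1] at h'
        exact lt_irrefl _ h'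
      exact IsLocalization.map_units Aq (⟨⟨z, hz⟩, hnot⟩ : (centreIdeal A O' hAO).primeCompl)
    obtain ⟨uβ, huβ⟩ := hunit β hβA hβ1
    obtain ⟨uα, huα⟩ := hunit α hαA hα1
    have hrel : algebraMap A Aq ⟨x₀, hx₀A⟩ * algebraMap A Aq ⟨β, hβA⟩ =
        algebraMap A Aq ⟨α, hαA⟩ * algebraMap A Aq ⟨u j, hu j⟩ := by
      rw [← map_mul, ← map_mul]
      congr 1
      exact Subtype.ext hkey
    have hx₀span : algebraMap A Aq ⟨x₀, hx₀A⟩ =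
        ↑uβ⁻¹ * (algebraMap A Aq ⟨α, hαA⟩ * algebraMap A Aq ⟨u j, hu j⟩) :=
      (Units.eq_inv_mul_iff_mul_eq uβ).mpr (by rw [huβ, mul_comm, hrel])
    have hu₀span : algebraMap A Aq ⟨u j, hu j⟩ =
        ↑uα⁻¹ * (algebraMap A Aq ⟨x₀, hx₀A⟩ * algebraMap A Aq ⟨β, hβA⟩) :=
      (Units.eq_inv_mul_iff_mul_eq uα).mpr (by rw [huα, hrel])
    have hgen0 : (⟨x j, hxA j⟩ : A) = ⟨x₀, hx₀A⟩ := Subtype.ext hx0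
    have hgens : ∀ i, i ≠ j → (⟨x i, hxA i⟩ : A) = ⟨u i, hu i⟩ := fun i hi =>
      Subtype.ext (hxne i hi)
    rw [hmax]
    apply le_antisymm
    · refine Ideal.span_le.mpr ?_
      rintro _ ⟨i, rfl⟩
      by_cases hi : i = j
      · rw [hi]
        change algebraMap A Aq ⟨u j, hu j⟩ ∈ _
        rw [hu₀span]
        refine Ideal.mul_mem_left _ _ (Ideal.mul_mem_right _ _ (Ideal.subset_span ⟨j, ?_⟩))
        change algebraMap A Aq ⟨x j, hxA j⟩ = _
        rw [hgen0]
      · refine Ideal.subset_span ⟨i, ?_⟩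
        change algebraMap A Aq ⟨x i, hxA i⟩ = algebraMap A Aq ⟨u i, hu i⟩
        rw [hgens i hi]
    · refine Ideal.span_le.mpr ?_
      rintro _ ⟨i, rfl⟩
      by_cases hi : i = j
      · rw [hi]
        change algebraMap A Aq ⟨x j, hxA j⟩ ∈ _
        rw [hgen0, hx₀span]
        refine Ideal.mul_mem_left _ _ (Ideal.mul_mem_left _ _ (Ideal.subset_span ⟨j, rfl⟩))
      · refine Ideal.subset_span ⟨i, ?_⟩
        change algebraMap A Aq ⟨u i, hu i⟩ = algebraMap A Aq ⟨x i, hxA i⟩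
        rw [hgens i hi]

/-- **FRAME LAW, Kummer form** (coordinate `0`, primitive `ζ`): the special case used by the Kummer cell.
[CossartPiltant2008, proof of Prop. 6.2 (2), (29)–(30)] [folklore] -/
theorem kummerFrame_of_stableHyperplane (σ : L ≃ₐ[k] L) {ℓ : ℕ} (hℓ : 0 < ℓ) (hℓk : (ℓ : k) ≠ 0)
    (hσℓ : σ ^ ℓ = 1) {ζ : k} (hζ : IsPrimitiveRoot ζ ℓ) (O' : ValuationSubring L)
    (A : Subalgebra k L) (hAO : A.toSubring ≤ O'.toSubring) (hAσ : ∀ a ∈ A, σ a ∈ A)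
    (u : Fin 4 → L) (hu : ∀ i, u i ∈ A)
    (hmax : IsLocalRing.maximalIdeal (Localization.AtPrime (centreIdeal A O' hAO)) =
      Ideal.span (Set.range fun i =>
        algebraMap A (Localization.AtPrime (centreIdeal A O' hAO)) ⟨u i, hu i⟩))
    (a b : ℕ → L) (haA : ∀ i, i < ℓ → a i ∈ A) (hbA : ∀ i, i < ℓ → b i ∈ A)
    (hb1 : ∀ i, i < ℓ → O'.valuation (b i) = 1)
    (horb : ∀ i, i < ℓ → (σ ^ i) (u 0) * b i = a i * u 0)
    (hres : ∀ i, i < ℓ → O'.valuation (a i - algebraMap k L (ζ ^ i) * b i) < 1) :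
    ∃ (x : Fin 4 → L) (hx : ∀ i, x i ∈ A),
      x 0 = reynolds σ (ζ ^ (ℓ - 1)) ℓ 1 (u 0) ∧ (∀ i : Fin 3, x i.succ = u i.succ) ∧
      σ (x 0) = algebraMap k L ζ * x 0 ∧ (∀ i, O'.valuation (x i) = O'.valuation (u i)) ∧
      IsLocalRing.maximalIdeal (Localization.AtPrime (centreIdeal A O' hAO)) =
        Ideal.span (Set.range fun i =>
          algebraMap A (Localization.AtPrime (centreIdeal A O' hAO)) ⟨x i, hx i⟩) := by
  obtain ⟨x, hx, hx0, hxne, hσ, hv, hm⟩ := eigenCoordinate_of_stableHyperplane σ hℓ hℓk hσℓ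
    hζ.pow_eq_one O' A hAO hAσ u hu hmax 0 a b haA hbA hb1 horb hres
  exact ⟨x, hx, hx0, fun i => hxne _ (Fin.succ_ne_zero i), hσ, hv, hm⟩

end Frame

end Summit.ResolutionOfSingularities.ResolutionOfSingularities.Theorems.EigenLadderLU
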